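import Literature.NumberTheory.Automorphic.Liu2021.AppendixC.HeckeEndomorphismTransposedWordScalar
import HarnessLib

/-!
# Liu 2021, Appendix C/D glue — the transposed Hecke word PACKAGED in the index currency of the (hx) fan word

[cite: Liu2021, p. 133 (before (D.3)): `ℍ_K ⊆ End(A_K)_ℚ` is the image of `C_c^∞(K\G(𝔸_F^∞)/K, ℚ) → End(A_K)_ℚ` induced by the Hecke
actions; §4.2 (FJcycle.tex l. 2070–2074)] [cite: Bump1997, §4.2 (Prop. 4.2.3: the double-coset operator `[KgK]` as a sum of
translates over `KgK/K`, coset counting)] [cite: MumfordAV1970, §19 (Hom(X,Y) first paragraph; Thm. 3: `End⁰ = ℚ ⊗ End`); §20 (p. 186,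
property (3) of e_n)]

PROOF lane; sequel of ★ `HeckeEndomorphismTransposedWord` (§1 (hx): `e⁻¹ (([KgK])_L) = #ι⁻¹ • (1 ⊗ Σ_{(γ,c′)} πY_K (bN c′) ≫ f (γ,c′) ≫ ιY_K (φ γ c′))`,
`f (γ,c′) = tt c′ ≫ Nm_{tp γ c′}`; §3 `algEquiv_symm_endAlgebraBaseChange_sum_smul`, `sum_smul_heckeEnd_mem_heckeImage`) and of ★
`HeckeEndomorphismTransposedWordScalar` (per translate `γ`, ONE brick `e⁻¹ (([Kγ′K])_L) = q_γ • (1 ⊗ Σ_{c′} πY_K (b_γ c′) ≫ ((m_γ c′ : ℤ) • g_γ c′) ≫ ιY_K (a_γ c′))`,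
`q_γ ≠ 0`).  This file is the PURE ASSEMBLY of the letter `hxd` (+ `hm`, `hf`) of the d6 frame's `slot_letters` in the INDEX CURRENCY
`I := ↥s × C_N` of the (hx) word: given the bricks, the identification of their entries with maps `fd (γ,c′) : J_K(φ γ c′) → J_K(bN c′)`
STATED IN `End(Y_K)` (`πY_K (b_γ c′) ≫ g_γ c′ ≫ ιY_K (a_γ c′) = πY_K (φ γ c′) ≫ fd (γ,c′) ≫ ιY_K (bN c′)` — homogeneous, no transport of
piece indices), entrywise level-adjoint pairs `(f (γ,c′), fd (γ,c′))` of raw weights `w (γ,c′)` and integers `M_γ`, `D ≠ 0` with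
`M_γ * m_γ c′ * w (γ,c′) = D`, the element `c := Σ_γ (M_γ / q_γ) • [Kγ′K] ∈ ℍ_K` satisfies
`e⁻¹ ((c)_L) = 1 ⊗ Σ_{(γ,c′)} πY_K (φ γ c′) ≫ (((M_γ * m_γ c′ : ℕ) : ℤ) • fd (γ,c′)) ≫ ιY_K (bN c′)` — the hypotheses of ★
`AbelianVariety.levelAdjoint_fan_sum_weighted` with `a i := bN i.2`, `b i := φ i.1 i.2`, `m i := M_{i.1} * m_{i.1} i.2`.

* §1 `zsmul_fan_entry_mul` — `(M : ℤ) • (π_b ≫ ((m : ℤ) • g) ≫ ι_a) = π_b′ ≫ ((M * m : ℤ) • fd) ≫ ι_a′` along an `End(Y_K)`-identification.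
* §2 `transposedWord_package_of_bricks` — the ∃-package `(fd, w, m, D, c)` with `hm`, `hxd`, `hf` (the last two letters of the frame's
  `slot_letters` and the weight bookkeeping), from the bricks, the identifications, the pairs and the integers;
  `transposedWord_package_of_bricks_of_stabilizer` — the same with STABILISER raw weights `#Stab_{Δ_γ}(ch_γ c′)` and index multipliers,
  all integers computed inside (`D := ∏_γ #Δ_γ`).

All model data (pieces, Jacobians, fans, piece maps, trace-word entries, bricks, pairs) are HYPOTHESES; no definition, no instance, no
named fact, no `sorry`.  The weight integers `(M, m, w, D)` are supplied by the caller in the general form (their arithmetic depends on the Galois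
groups of the piece covers) and computed here in the stabiliser form.
-/

open CategoryTheory CategoryTheory.Limits AlgebraicGeometry MonoidalCategory CartesianMonoidalCategory NumberField Function MulAction
open Literature.AlgebraicGeometry.Motives

namespace Literature.NumberTheory.Automorphic.Liu2021.AppendixC

open AbelianVariety (bcSpec bcFunctor endAlgebra rationalTateModuleMap endAlgebraBaseChange)

universe u

/-! ## §1 Moving two integer weights through an `End(Y_K)`-identification of a fan entry -/

/-- **Two integer weights through an identified fan entry**: if `π_b ≫ g ≫ ι_a = π_{b′} ≫ fd ≫ ι_{a′}` in `End(Y)`, then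
`(M : ℤ) • (π_b ≫ ((m : ℤ) • g) ≫ ι_a) = π_{b′} ≫ (((M * m : ℕ) : ℤ) • fd) ≫ ι_{a′}` (bilinearity of composition).
[cite: MumfordAV1970, §19 (Hom(X,Y), first paragraph)] -/
theorem zsmul_fan_entry_mul {L : Type u} [Field L] {Y J₁ J₂ J₁' J₂' : AbelianVariety L} (π : Y ⟶ J₁) (g : J₁ ⟶ J₂) (ι : J₂ ⟶ Y)
    (π' : Y ⟶ J₁') (fd : J₁' ⟶ J₂') (ι' : J₂' ⟶ Y) (h : π ≫ g ≫ ι = π' ≫ fd ≫ ι') (M m : ℕ) :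
    (M : ℤ) • (π ≫ ((m : ℤ) • g) ≫ ι) = π' ≫ (((M * m : ℕ) : ℤ) • fd) ≫ ι' := by
  rw [← zsmul_fan_entry, smul_smul, h, Nat.cast_mul, zsmul_fan_entry]

-- `(A.baseChange L).X` is `(bcFunctor E L).obj A.X` only up to unfolding `AbelianVariety.baseChange` (as in ★ `HeckeEndomorphismComplexWord`)
set_option backward.isDefEq.respectTransparency false

variable {F E : Type} [Field F] [NumberField F] [IsTotallyReal F] [Field E] [NumberField E] [Algebra F E]
  [IsTotallyComplex E] [Algebra.IsQuadraticExtension F E]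
variable {P5 : PropC5Data F E} {isotropicAt : ℕ → Prop}

namespace Sec42Data.HeckeTranslates

variable {C : Sec42Data P5 isotropicAt} (T : C.HeckeTranslates) (L : Type) [Field L] [Algebra E L]
variable {N K : C5.SmallLevel C.S.K₀}
-- pieces of `X_N ⊗ L` with their Jacobians (the deeper normal level of the (hx) word)
variable {CN : Type} [Fintype CN] (EN : CN → SchemeOver L) (JN : ∀ c, Jacobian (EN c))
-- pieces of `X_K ⊗ L` with their Jacobians, the fan of the model `Y_K` and the K-level thetas
variable {CK : Type} (EK : CK → SchemeOver L) (JK : ∀ c, Jacobian (EK c)) (YK : AbelianVariety L)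
  (πK : ∀ c, YK ⟶ (JK c).J) (ιK : ∀ c, (JK c).J ⟶ YK) (WK : ∀ c, CartierDivisor (JK c).J.X.left)

/-! ## §2 The package `(fd, w, m, D, c)` in the index currency `↥s × C_N` -/

/-- **THE TRANSPOSED WORD, PACKAGED** (letters `hm`, `hxd`, `hf` of the d6 frame's `slot_letters`).  Data: the (hx) index data — a
finite set `s` of translates, piece maps `φ γ : C_N → C_K`, `tp γ c′ : E_N c′ → E_K (φ γ c′)` of the `T_γ`, the trace-word entries
`bN : C_N → C_K`, `tt c′ : J_K(bN c′) → J_N c′` —; per translate `γ ∈ s` ONE BRICK (★ `HeckeEndomorphismTransposedWordScalar`):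
`e⁻¹ (([K(xg γ)K])_L) = q γ • (1 ⊗ Σ_{c′} πY_K (bs γ c′) ≫ ((mst γ c′ : ℤ) • g γ c′) ≫ ιY_K (as γ c′))` with `q γ ≠ 0`; maps
`fd (γ,c′) : J_K(φ γ c′) → J_K(bN c′)` identified with the brick entries IN `End(Y_K)`; entrywise level-adjoint pairs `(f, fd)` of raw
weights `w` for the K-level thetas, `f (γ,c′) = tt c′ ≫ Nm_{tp γ c′}`; integers `M γ`, `D ≠ 0` with `M γ * mst γ c′ * w (γ,c′) = D`.
Then `∃ fd w m D (D ≠ 0) (∀ i, m i * w i = D) (c ∈ ℍ_K)` with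
`e⁻¹ ((c)_L) = 1 ⊗ Σ_{i ∈ s × C_N} πY_K (φ i.1 i.2) ≫ ((m i : ℤ) • fd i) ≫ ιY_K (bN i.2)` and the pairs — namely
`c := Σ_γ (M γ / q γ) • [K(xg γ)K]` (★ `sum_smul_heckeEnd_mem_heckeImage`, ★ `algEquiv_symm_endAlgebraBaseChange_sum_smul`),
`m (γ,c′) := M γ * mst γ c′`. [cite: Liu2021, p. 133 (before (D.3)) and §4.2 (FJcycle.tex l. 2074)] [cite: Bump1997, §4.2 (Prop. 4.2.3)]
[cite: MumfordAV1970, §19 Thm. 3; §20 (p. 186, property (3) of e_n)] -/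
theorem transposedWord_package_of_bricks (hD : T.IsogenyDescent) (e : YK.endAlgebra ≃ₐ[ℚ] ((C.A K).baseChange L).endAlgebra)
    (s : Finset C.G) (φ : ↥s → CN → CK) (tp : ∀ (γ : ↥s) (c' : CN), EN c' ⟶ EK (φ γ c'))
    (bN : CN → CK) (tt : ∀ c', (JK (bN c')).J ⟶ (JN c').J)
    -- the bricks, one per translate, in section form
    (xg : ↥s → C.G) (q : ↥s → ℚ) (bs as : ↥s → CN → CK) (g : ∀ (γ : ↥s) (c' : CN), (JK (bs γ c')).J ⟶ (JK (as γ c')).J)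
    (mst : ↥s → CN → ℕ) (hq : ∀ γ, q γ ≠ 0)
    (hbrick : ∀ γ, e.symm (endAlgebraBaseChange L (C.A K) (T.heckeEnd hD K (xg γ))) =
      q γ • endAlgebra.of YK (∑ c', πK (bs γ c') ≫ ((mst γ c' : ℤ) • g γ c') ≫ ιK (as γ c')))
    -- the identification of the brick entries with the transposed entries, in `End(Y_K)`
    (fd : ∀ i : ↥s × CN, (JK (φ i.1 i.2)).J ⟶ (JK (bN i.2)).J)
    (hfd : ∀ (γ : ↥s) (c' : CN), πK (bs γ c') ≫ g γ c' ≫ ιK (as γ c') = πK (φ γ c') ≫ fd (γ, c') ≫ ιK (bN c'))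
    -- the entrywise level-adjoint pairs of raw weights `w`
    (w : ↥s × CN → ℕ)
    (hf : ∀ (i : ↥s × CN) (n : ℕ) [IsDominant (AbelianVariety.Hom.toSchemeHom ((n : ℤ) • 𝟙 (JK (bN i.2)).J))]
      [IsDominant (AbelianVariety.Hom.toSchemeHom ((n : ℤ) • 𝟙 (JK (φ i.1 i.2)).J))]
      (P : (JK (bN i.2)).J.torsionPoints L n) (Q : (JK (φ i.1 i.2)).J.torsionPoints L n),
      (JK (φ i.1 i.2)).J.weilPairingLevel (WK (φ i.1 i.2))
          ⟨AlgPoints.map ((w i : ℤ) • (tt i.2 ≫ (JN i.2).pushforward (JK (φ i.1 i.2)) (tp i.1 i.2))).hom.hom.hom P.1,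
            AbelianVariety.map_mem_torsionPoints ((w i : ℤ) • (tt i.2 ≫ (JN i.2).pushforward (JK (φ i.1 i.2)) (tp i.1 i.2))) P.2⟩ Q =
        (JK (bN i.2)).J.weilPairingLevel (WK (bN i.2)) P
          ⟨AlgPoints.map (fd i).hom.hom.hom Q.1, AbelianVariety.map_mem_torsionPoints (fd i) Q.2⟩)
    -- the integers
    (M : ↥s → ℕ) (D : ℕ) (hD0 : D ≠ 0) (hw : ∀ (γ : ↥s) (c' : CN), M γ * mst γ c' * w (γ, c') = D) :
    ∃ (fd : ∀ i : ↥s × CN, (JK (φ i.1 i.2)).J ⟶ (JK (bN i.2)).J) (w m : ↥s × CN → ℕ) (D : ℕ) (_ : D ≠ 0)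
      (_ : ∀ i ∈ s.attach ×ˢ (Finset.univ : Finset CN), m i * w i = D) (c : ↥(T.heckeImage hD K)),
      e.symm (endAlgebraBaseChange L (C.A K) (c : (C.A K).endAlgebra)) =
          endAlgebra.of YK (∑ i ∈ s.attach ×ˢ (Finset.univ : Finset CN), πK (φ i.1 i.2) ≫ ((m i : ℤ) • fd i) ≫ ιK (bN i.2)) ∧
        ∀ i ∈ s.attach ×ˢ (Finset.univ : Finset CN), ∀ (n : ℕ) [IsDominant (AbelianVariety.Hom.toSchemeHom ((n : ℤ) • 𝟙 (JK (bN i.2)).J))]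
          [IsDominant (AbelianVariety.Hom.toSchemeHom ((n : ℤ) • 𝟙 (JK (φ i.1 i.2)).J))]
          (P : (JK (bN i.2)).J.torsionPoints L n) (Q : (JK (φ i.1 i.2)).J.torsionPoints L n),
          (JK (φ i.1 i.2)).J.weilPairingLevel (WK (φ i.1 i.2))
              ⟨AlgPoints.map ((w i : ℤ) • (tt i.2 ≫ (JN i.2).pushforward (JK (φ i.1 i.2)) (tp i.1 i.2))).hom.hom.hom P.1,
                AbelianVariety.map_mem_torsionPoints ((w i : ℤ) • (tt i.2 ≫ (JN i.2).pushforward (JK (φ i.1 i.2)) (tp i.1 i.2))) P.2⟩ Q =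
            (JK (bN i.2)).J.weilPairingLevel (WK (bN i.2)) P
              ⟨AlgPoints.map (fd i).hom.hom.hom Q.1, AbelianVariety.map_mem_torsionPoints (fd i) Q.2⟩ := by
  classical
  refine ⟨fd, w, fun i => M i.1 * mst i.1 i.2, D, hD0, fun i _ => ?_,
    ⟨∑ γ ∈ s.attach, ((M γ : ℤ) / q γ : ℚ) • T.heckeEnd hD K (xg γ),
      T.sum_smul_heckeEnd_mem_heckeImage hD K s.attach (fun γ => ((M γ : ℤ) / q γ : ℚ)) xg⟩, ?_, fun i _ n _ _ P Q => hf i n P Q⟩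
  · -- `m i * w i = D`
    exact hw i.1 i.2
  · -- `hxd`: ★ `algEquiv_symm_endAlgebraBaseChange_sum_smul` over the translates, then the identifications entrywise
    change e.symm (endAlgebraBaseChange L (C.A K) (∑ γ ∈ s.attach, ((M γ : ℤ) / q γ : ℚ) • T.heckeEnd hD K (xg γ))) = _
    rw [algEquiv_symm_endAlgebraBaseChange_sum_smul L YK e s.attach (fun γ => T.heckeEnd hD K (xg γ))
      (fun γ => ∑ c', πK (bs γ c') ≫ ((mst γ c' : ℤ) • g γ c') ≫ ιK (as γ c')) q (fun γ => (M γ : ℤ)) (fun γ _ => hq γ)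
      (fun γ _ => hbrick γ), Finset.sum_product]
    congr 1
    refine Finset.sum_congr rfl fun γ _ => ?_
    rw [Finset.smul_sum]
    exact Finset.sum_congr rfl fun c' _ => zsmul_fan_entry_mul _ _ _ _ _ _ (hfd γ c') (M γ) (mst γ c')

/-- **THE TRANSPOSED WORD, PACKAGED — STABILISER WEIGHTS** ((L) pen ruling: the raw weight of the entrywise pair is the order of the
STABILISER `Stab_{Δ_γ}(ch_γ c′)` of the chosen piece in the deck group `Δ_γ` of the brick, the kernel of `Stab → Aut` being absorbed
into `fd` by the caller; the brick multipliers are the indices, `mst γ c′ * #Stab_{Δ_γ}(ch_γ c′) = #Δ_γ`).  Then ALL the integers are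
computed here: `D := ∏_{γ ∈ s} #Δ_γ ≠ 0`, `M γ := D / #Δ_γ`, `m (γ,c′) := M γ * mst γ c′`, `w (γ,c′) := #Stab_{Δ_γ}(ch_γ c′)`, and
`m (γ,c′) * w (γ,c′) = D`; the conclusion is that of `transposedWord_package_of_bricks`.
[cite: Bump1997, §4.2 (Prop. 4.2.3: coset counting for double-coset operators)] [cite: MumfordAV1970, §19 Thm. 3; §20 (p. 186, property (3) of e_n)] -/
theorem transposedWord_package_of_bricks_of_stabilizer (hD : T.IsogenyDescent)
    (e : YK.endAlgebra ≃ₐ[ℚ] ((C.A K).baseChange L).endAlgebra)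
    (s : Finset C.G) (φ : ↥s → CN → CK) (tp : ∀ (γ : ↥s) (c' : CN), EN c' ⟶ EK (φ γ c'))
    (bN : CN → CK) (tt : ∀ c', (JK (bN c')).J ⟶ (JN c').J)
    -- the deck groups of the bricks acting on the pieces of the refined levels, and the chosen pieces
    {C'' : ↥s → Type} [∀ γ, DecidableEq (C'' γ)] (Δ : ↥s → Type) [∀ γ, Group (Δ γ)] [∀ γ, Fintype (Δ γ)]
    [∀ γ, MulAction (Δ γ) (C'' γ)] (ch : ∀ γ : ↥s, CN → C'' γ)
    -- the bricks, one per translate, in section form, with the INDEX multipliers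
    (xg : ↥s → C.G) (q : ↥s → ℚ) (bs as : ↥s → CN → CK) (g : ∀ (γ : ↥s) (c' : CN), (JK (bs γ c')).J ⟶ (JK (as γ c')).J)
    (mst : ↥s → CN → ℕ) (hmst : ∀ (γ : ↥s) (c' : CN), mst γ c' * Fintype.card ↥(stabilizer (Δ γ) (ch γ c')) = Fintype.card (Δ γ))
    (hq : ∀ γ, q γ ≠ 0)
    (hbrick : ∀ γ, e.symm (endAlgebraBaseChange L (C.A K) (T.heckeEnd hD K (xg γ))) =
      q γ • endAlgebra.of YK (∑ c', πK (bs γ c') ≫ ((mst γ c' : ℤ) • g γ c') ≫ ιK (as γ c')))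
    -- the identification of the brick entries with the transposed entries, in `End(Y_K)`
    (fd : ∀ i : ↥s × CN, (JK (φ i.1 i.2)).J ⟶ (JK (bN i.2)).J)
    (hfd : ∀ (γ : ↥s) (c' : CN), πK (bs γ c') ≫ g γ c' ≫ ιK (as γ c') = πK (φ γ c') ≫ fd (γ, c') ≫ ιK (bN c'))
    -- the entrywise level-adjoint pairs of raw weight `#Stab_{Δ_γ}(ch_γ c′)`
    (hf : ∀ (i : ↥s × CN) (n : ℕ) [IsDominant (AbelianVariety.Hom.toSchemeHom ((n : ℤ) • 𝟙 (JK (bN i.2)).J))]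
      [IsDominant (AbelianVariety.Hom.toSchemeHom ((n : ℤ) • 𝟙 (JK (φ i.1 i.2)).J))]
      (P : (JK (bN i.2)).J.torsionPoints L n) (Q : (JK (φ i.1 i.2)).J.torsionPoints L n),
      (JK (φ i.1 i.2)).J.weilPairingLevel (WK (φ i.1 i.2))
          ⟨AlgPoints.map (((Fintype.card ↥(stabilizer (Δ i.1) (ch i.1 i.2)) : ℕ) : ℤ) •
              (tt i.2 ≫ (JN i.2).pushforward (JK (φ i.1 i.2)) (tp i.1 i.2))).hom.hom.hom P.1,
            AbelianVariety.map_mem_torsionPoints (((Fintype.card ↥(stabilizer (Δ i.1) (ch i.1 i.2)) : ℕ) : ℤ) •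
              (tt i.2 ≫ (JN i.2).pushforward (JK (φ i.1 i.2)) (tp i.1 i.2))) P.2⟩ Q =
        (JK (bN i.2)).J.weilPairingLevel (WK (bN i.2)) P
          ⟨AlgPoints.map (fd i).hom.hom.hom Q.1, AbelianVariety.map_mem_torsionPoints (fd i) Q.2⟩) :
    ∃ (fd : ∀ i : ↥s × CN, (JK (φ i.1 i.2)).J ⟶ (JK (bN i.2)).J) (w m : ↥s × CN → ℕ) (D : ℕ) (_ : D ≠ 0)
      (_ : ∀ i ∈ s.attach ×ˢ (Finset.univ : Finset CN), m i * w i = D) (c : ↥(T.heckeImage hD K)),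
      e.symm (endAlgebraBaseChange L (C.A K) (c : (C.A K).endAlgebra)) =
          endAlgebra.of YK (∑ i ∈ s.attach ×ˢ (Finset.univ : Finset CN), πK (φ i.1 i.2) ≫ ((m i : ℤ) • fd i) ≫ ιK (bN i.2)) ∧
        ∀ i ∈ s.attach ×ˢ (Finset.univ : Finset CN), ∀ (n : ℕ) [IsDominant (AbelianVariety.Hom.toSchemeHom ((n : ℤ) • 𝟙 (JK (bN i.2)).J))]
          [IsDominant (AbelianVariety.Hom.toSchemeHom ((n : ℤ) • 𝟙 (JK (φ i.1 i.2)).J))]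
          (P : (JK (bN i.2)).J.torsionPoints L n) (Q : (JK (φ i.1 i.2)).J.torsionPoints L n),
          (JK (φ i.1 i.2)).J.weilPairingLevel (WK (φ i.1 i.2))
              ⟨AlgPoints.map ((w i : ℤ) • (tt i.2 ≫ (JN i.2).pushforward (JK (φ i.1 i.2)) (tp i.1 i.2))).hom.hom.hom P.1,
                AbelianVariety.map_mem_torsionPoints ((w i : ℤ) • (tt i.2 ≫ (JN i.2).pushforward (JK (φ i.1 i.2)) (tp i.1 i.2))) P.2⟩ Q =
            (JK (bN i.2)).J.weilPairingLevel (WK (bN i.2)) P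
              ⟨AlgPoints.map (fd i).hom.hom.hom Q.1, AbelianVariety.map_mem_torsionPoints (fd i) Q.2⟩ := by
  classical
  -- the integers: `D := ∏_γ #Δ_γ`, `M γ := D / #Δ_γ`
  have hΔ0 : ∀ γ : ↥s, Fintype.card (Δ γ) ≠ 0 := fun γ => Fintype.card_ne_zero
  have hD0 : ∏ γ ∈ s.attach, Fintype.card (Δ γ) ≠ 0 := Finset.prod_ne_zero_iff.mpr fun γ _ => hΔ0 γ
  have hdvd : ∀ γ : ↥s, Fintype.card (Δ γ) ∣ ∏ γ' ∈ s.attach, Fintype.card (Δ γ') := fun γ =>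
    Finset.dvd_prod_of_mem (fun γ' => Fintype.card (Δ γ')) (Finset.mem_attach s γ)
  refine T.transposedWord_package_of_bricks L EN JN EK JK YK πK ιK WK hD e s φ tp bN tt xg q bs as g mst hq hbrick fd hfd
    (fun i => Fintype.card ↥(stabilizer (Δ i.1) (ch i.1 i.2))) hf
    (fun γ => (∏ γ' ∈ s.attach, Fintype.card (Δ γ')) / Fintype.card (Δ γ)) (∏ γ ∈ s.attach, Fintype.card (Δ γ)) hD0
    fun γ c' => ?_
  -- `(D / #Δ_γ) * mst γ c′ * #Stab = (D / #Δ_γ) * #Δ_γ = D`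
  rw [mul_assoc, hmst γ c', Nat.div_mul_cancel (hdvd γ)]

end Sec42Data.HeckeTranslates

end Literature.NumberTheory.Automorphic.Liu2021.AppendixC

/-! ## §3 (edition 2) — the package with ANY raw weights tied to the deck group orders (multiplicity-one regime) -/

namespace Literature.NumberTheory.Automorphic.Liu2021.AppendixC

open AbelianVariety (bcSpec bcFunctor endAlgebra rationalTateModuleMap endAlgebraBaseChange)

-- `(A.baseChange L).X` is `(bcFunctor E L).obj A.X` only up to unfolding `AbelianVariety.baseChange` (as in ★ `HeckeEndomorphismComplexWord`)
set_option backward.isDefEq.respectTransparency false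

variable {F E : Type} [Field F] [NumberField F] [IsTotallyReal F] [Field E] [NumberField E] [Algebra F E]
  [IsTotallyComplex E] [Algebra.IsQuadraticExtension F E]
variable {P5 : PropC5Data F E} {isotropicAt : ℕ → Prop}

namespace Sec42Data.HeckeTranslates

variable {C : Sec42Data P5 isotropicAt} (T : C.HeckeTranslates) (L : Type) [Field L] [Algebra E L]
variable {N K : C5.SmallLevel C.S.K₀}
variable {CN : Type} [Fintype CN] (EN : CN → SchemeOver L) (JN : ∀ c, Jacobian (EN c))
variable {CK : Type} (EK : CK → SchemeOver L) (JK : ∀ c, Jacobian (EK c)) (YK : AbelianVariety L)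
  (πK : ∀ c, YK ⟶ (JK c).J) (ιK : ∀ c, (JK c).J ⟶ YK) (WK : ∀ c, CartierDivisor (JK c).J.X.left)

/-- **THE TRANSPOSED WORD, PACKAGED — RAW WEIGHTS TIED TO THE DECK GROUP ORDERS** (edition 2; the multiplicity-one regime of ★
`exists_fan_traceWord_of_rigid_injective` / ★ `exists_pushPull_package_inj`).  As `transposedWord_package_of_bricks`, with per translate
`γ` a finite deck group `Δ γ` (only its ORDER enters) and, per entry, an arbitrary raw weight `w (γ,c′)` tied to the brick multiplier by
`mst γ c′ * w (γ,c′) = #Δ_γ` — e.g. `mst γ c′ = [Δ_γ : Stab(ch c′)]` (★ `HeckeEndomorphismTransposedWordScalar`) and `w (γ,c′) = #H_q(ch c′)`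
(★ `Jacobian.exists_entry_package`) `= #Stab(ch c′)` (★ `fintypeCard_pieceGroup_eq_card_stabilizer`, piecewise rigidity).  ALL integers are
computed here: `D := ∏_{γ ∈ s} #Δ_γ ≠ 0`, `M γ := D / #Δ_γ`, `m (γ,c′) := M γ * mst γ c′`; the letter never mentions a stabiliser, so no
dependent rewriting of the pair hypotheses is needed downstream. [cite: Bump1997, §4.2 (Prop. 4.2.3: coset counting for double-coset operators)]
[cite: MumfordAV1970, §19 Thm. 3; §20 (p. 186, property (3) of e_n)] -/
theorem transposedWord_package_of_bricks_of_card (hD : T.IsogenyDescent)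
    (e : YK.endAlgebra ≃ₐ[ℚ] ((C.A K).baseChange L).endAlgebra)
    (s : Finset C.G) (φ : ↥s → CN → CK) (tp : ∀ (γ : ↥s) (c' : CN), EN c' ⟶ EK (φ γ c'))
    (bN : CN → CK) (tt : ∀ c', (JK (bN c')).J ⟶ (JN c').J)
    -- the deck groups of the bricks (only their orders enter)
    (Δ : ↥s → Type) [∀ γ, Group (Δ γ)] [∀ γ, Fintype (Δ γ)]
    -- the bricks, one per translate, in section form
    (xg : ↥s → C.G) (q : ↥s → ℚ) (bs as : ↥s → CN → CK) (g : ∀ (γ : ↥s) (c' : CN), (JK (bs γ c')).J ⟶ (JK (as γ c')).J)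
    (mst : ↥s → CN → ℕ) (hq : ∀ γ, q γ ≠ 0)
    (hbrick : ∀ γ, e.symm (endAlgebraBaseChange L (C.A K) (T.heckeEnd hD K (xg γ))) =
      q γ • endAlgebra.of YK (∑ c', πK (bs γ c') ≫ ((mst γ c' : ℤ) • g γ c') ≫ ιK (as γ c')))
    -- the identification of the brick entries with the transposed entries, in `End(Y_K)`
    (fd : ∀ i : ↥s × CN, (JK (φ i.1 i.2)).J ⟶ (JK (bN i.2)).J)
    (hfd : ∀ (γ : ↥s) (c' : CN), πK (bs γ c') ≫ g γ c' ≫ ιK (as γ c') = πK (φ γ c') ≫ fd (γ, c') ≫ ιK (bN c'))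
    -- the entrywise level-adjoint pairs of raw weights `w`, tied to the deck group orders
    (w : ↥s × CN → ℕ) (hwst : ∀ (γ : ↥s) (c' : CN), mst γ c' * w (γ, c') = Fintype.card (Δ γ))
    (hf : ∀ (i : ↥s × CN) (n : ℕ) [IsDominant (AbelianVariety.Hom.toSchemeHom ((n : ℤ) • 𝟙 (JK (bN i.2)).J))]
      [IsDominant (AbelianVariety.Hom.toSchemeHom ((n : ℤ) • 𝟙 (JK (φ i.1 i.2)).J))]
      (P : (JK (bN i.2)).J.torsionPoints L n) (Q : (JK (φ i.1 i.2)).J.torsionPoints L n),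
      (JK (φ i.1 i.2)).J.weilPairingLevel (WK (φ i.1 i.2))
          ⟨AlgPoints.map ((w i : ℤ) • (tt i.2 ≫ (JN i.2).pushforward (JK (φ i.1 i.2)) (tp i.1 i.2))).hom.hom.hom P.1,
            AbelianVariety.map_mem_torsionPoints ((w i : ℤ) • (tt i.2 ≫ (JN i.2).pushforward (JK (φ i.1 i.2)) (tp i.1 i.2))) P.2⟩ Q =
        (JK (bN i.2)).J.weilPairingLevel (WK (bN i.2)) P
          ⟨AlgPoints.map (fd i).hom.hom.hom Q.1, AbelianVariety.map_mem_torsionPoints (fd i) Q.2⟩) :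
    ∃ (fd : ∀ i : ↥s × CN, (JK (φ i.1 i.2)).J ⟶ (JK (bN i.2)).J) (w m : ↥s × CN → ℕ) (D : ℕ) (_ : D ≠ 0)
      (_ : ∀ i ∈ s.attach ×ˢ (Finset.univ : Finset CN), m i * w i = D) (c : ↥(T.heckeImage hD K)),
      e.symm (endAlgebraBaseChange L (C.A K) (c : (C.A K).endAlgebra)) =
          endAlgebra.of YK (∑ i ∈ s.attach ×ˢ (Finset.univ : Finset CN), πK (φ i.1 i.2) ≫ ((m i : ℤ) • fd i) ≫ ιK (bN i.2)) ∧
        ∀ i ∈ s.attach ×ˢ (Finset.univ : Finset CN), ∀ (n : ℕ) [IsDominant (AbelianVariety.Hom.toSchemeHom ((n : ℤ) • 𝟙 (JK (bN i.2)).J))]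
          [IsDominant (AbelianVariety.Hom.toSchemeHom ((n : ℤ) • 𝟙 (JK (φ i.1 i.2)).J))]
          (P : (JK (bN i.2)).J.torsionPoints L n) (Q : (JK (φ i.1 i.2)).J.torsionPoints L n),
          (JK (φ i.1 i.2)).J.weilPairingLevel (WK (φ i.1 i.2))
              ⟨AlgPoints.map ((w i : ℤ) • (tt i.2 ≫ (JN i.2).pushforward (JK (φ i.1 i.2)) (tp i.1 i.2))).hom.hom.hom P.1,
                AbelianVariety.map_mem_torsionPoints ((w i : ℤ) • (tt i.2 ≫ (JN i.2).pushforward (JK (φ i.1 i.2)) (tp i.1 i.2))) P.2⟩ Q =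
            (JK (bN i.2)).J.weilPairingLevel (WK (bN i.2)) P
              ⟨AlgPoints.map (fd i).hom.hom.hom Q.1, AbelianVariety.map_mem_torsionPoints (fd i) Q.2⟩ := by
  classical
  -- the integers: `D := ∏_γ #Δ_γ`, `M γ := D / #Δ_γ`
  have hΔ0 : ∀ γ : ↥s, Fintype.card (Δ γ) ≠ 0 := fun γ => Fintype.card_ne_zero
  have hD0 : ∏ γ ∈ s.attach, Fintype.card (Δ γ) ≠ 0 := Finset.prod_ne_zero_iff.mpr fun γ _ => hΔ0 γ
  have hdvd : ∀ γ : ↥s, Fintype.card (Δ γ) ∣ ∏ γ' ∈ s.attach, Fintype.card (Δ γ') := fun γ =>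
    Finset.dvd_prod_of_mem (fun γ' => Fintype.card (Δ γ')) (Finset.mem_attach s γ)
  refine T.transposedWord_package_of_bricks L EN JN EK JK YK πK ιK WK hD e s φ tp bN tt xg q bs as g mst hq hbrick fd hfd w hf
    (fun γ => (∏ γ' ∈ s.attach, Fintype.card (Δ γ')) / Fintype.card (Δ γ)) (∏ γ ∈ s.attach, Fintype.card (Δ γ)) hD0
    fun γ c' => ?_
  -- `(D / #Δ_γ) * mst γ c′ * w = (D / #Δ_γ) * #Δ_γ = D`
  rw [mul_assoc, hwst γ c', Nat.div_mul_cancel (hdvd γ)]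

/-- **THE TRANSPOSED WORD, PACKAGED — RAW WEIGHTS TIED TO ANY PER-TRANSLATE CONSTANTS** (edition 3): as
`transposedWord_package_of_bricks_of_card` with the deck group orders replaced by arbitrary non-zero naturals `n γ`
(`mst γ c′ * w (γ,c′) = n γ`; e.g. `n γ = #Δ_γ · m₀″_γ` when the brick's trace word carries a constant multiplicity `m₀″_γ`);
`D := ∏_{γ ∈ s} n γ`, `M γ := D / n γ`. [cite: Bump1997, §4.2 (Prop. 4.2.3: coset counting for double-coset operators)]
[cite: MumfordAV1970, §19 Thm. 3; §20 (p. 186, property (3) of e_n)] -/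
theorem transposedWord_package_of_bricks_of_nat (hD : T.IsogenyDescent)
    (e : YK.endAlgebra ≃ₐ[ℚ] ((C.A K).baseChange L).endAlgebra)
    (s : Finset C.G) (φ : ↥s → CN → CK) (tp : ∀ (γ : ↥s) (c' : CN), EN c' ⟶ EK (φ γ c'))
    (bN : CN → CK) (tt : ∀ c', (JK (bN c')).J ⟶ (JN c').J)
    -- the per-translate constants
    (n : ↥s → ℕ) (hn : ∀ γ, n γ ≠ 0)
    -- the bricks, one per translate, in section form
    (xg : ↥s → C.G) (q : ↥s → ℚ) (bs as : ↥s → CN → CK) (g : ∀ (γ : ↥s) (c' : CN), (JK (bs γ c')).J ⟶ (JK (as γ c')).J)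
    (mst : ↥s → CN → ℕ) (hq : ∀ γ, q γ ≠ 0)
    (hbrick : ∀ γ, e.symm (endAlgebraBaseChange L (C.A K) (T.heckeEnd hD K (xg γ))) =
      q γ • endAlgebra.of YK (∑ c', πK (bs γ c') ≫ ((mst γ c' : ℤ) • g γ c') ≫ ιK (as γ c')))
    -- the identification of the brick entries with the transposed entries, in `End(Y_K)`
    (fd : ∀ i : ↥s × CN, (JK (φ i.1 i.2)).J ⟶ (JK (bN i.2)).J)
    (hfd : ∀ (γ : ↥s) (c' : CN), πK (bs γ c') ≫ g γ c' ≫ ιK (as γ c') = πK (φ γ c') ≫ fd (γ, c') ≫ ιK (bN c'))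
    -- the entrywise level-adjoint pairs of raw weights `w`, tied to the constants
    (w : ↥s × CN → ℕ) (hwst : ∀ (γ : ↥s) (c' : CN), mst γ c' * w (γ, c') = n γ)
    (hf : ∀ (i : ↥s × CN) (n : ℕ) [IsDominant (AbelianVariety.Hom.toSchemeHom ((n : ℤ) • 𝟙 (JK (bN i.2)).J))]
      [IsDominant (AbelianVariety.Hom.toSchemeHom ((n : ℤ) • 𝟙 (JK (φ i.1 i.2)).J))]
      (P : (JK (bN i.2)).J.torsionPoints L n) (Q : (JK (φ i.1 i.2)).J.torsionPoints L n),
      (JK (φ i.1 i.2)).J.weilPairingLevel (WK (φ i.1 i.2))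
          ⟨AlgPoints.map ((w i : ℤ) • (tt i.2 ≫ (JN i.2).pushforward (JK (φ i.1 i.2)) (tp i.1 i.2))).hom.hom.hom P.1,
            AbelianVariety.map_mem_torsionPoints ((w i : ℤ) • (tt i.2 ≫ (JN i.2).pushforward (JK (φ i.1 i.2)) (tp i.1 i.2))) P.2⟩ Q =
        (JK (bN i.2)).J.weilPairingLevel (WK (bN i.2)) P
          ⟨AlgPoints.map (fd i).hom.hom.hom Q.1, AbelianVariety.map_mem_torsionPoints (fd i) Q.2⟩) :
    ∃ (fd : ∀ i : ↥s × CN, (JK (φ i.1 i.2)).J ⟶ (JK (bN i.2)).J) (w m : ↥s × CN → ℕ) (D : ℕ) (_ : D ≠ 0)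
      (_ : ∀ i ∈ s.attach ×ˢ (Finset.univ : Finset CN), m i * w i = D) (c : ↥(T.heckeImage hD K)),
      e.symm (endAlgebraBaseChange L (C.A K) (c : (C.A K).endAlgebra)) =
          endAlgebra.of YK (∑ i ∈ s.attach ×ˢ (Finset.univ : Finset CN), πK (φ i.1 i.2) ≫ ((m i : ℤ) • fd i) ≫ ιK (bN i.2)) ∧
        ∀ i ∈ s.attach ×ˢ (Finset.univ : Finset CN), ∀ (n : ℕ) [IsDominant (AbelianVariety.Hom.toSchemeHom ((n : ℤ) • 𝟙 (JK (bN i.2)).J))]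
          [IsDominant (AbelianVariety.Hom.toSchemeHom ((n : ℤ) • 𝟙 (JK (φ i.1 i.2)).J))]
          (P : (JK (bN i.2)).J.torsionPoints L n) (Q : (JK (φ i.1 i.2)).J.torsionPoints L n),
          (JK (φ i.1 i.2)).J.weilPairingLevel (WK (φ i.1 i.2))
              ⟨AlgPoints.map ((w i : ℤ) • (tt i.2 ≫ (JN i.2).pushforward (JK (φ i.1 i.2)) (tp i.1 i.2))).hom.hom.hom P.1,
                AbelianVariety.map_mem_torsionPoints ((w i : ℤ) • (tt i.2 ≫ (JN i.2).pushforward (JK (φ i.1 i.2)) (tp i.1 i.2))) P.2⟩ Q =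
            (JK (bN i.2)).J.weilPairingLevel (WK (bN i.2)) P
              ⟨AlgPoints.map (fd i).hom.hom.hom Q.1, AbelianVariety.map_mem_torsionPoints (fd i) Q.2⟩ := by
  classical
  -- the integers: `D := ∏_γ n γ`, `M γ := D / n γ`
  have hD0 : ∏ γ ∈ s.attach, n γ ≠ 0 := Finset.prod_ne_zero_iff.mpr fun γ _ => hn γ
  have hdvd : ∀ γ : ↥s, n γ ∣ ∏ γ' ∈ s.attach, n γ' := fun γ => Finset.dvd_prod_of_mem n (Finset.mem_attach s γ)
  refine T.transposedWord_package_of_bricks L EN JN EK JK YK πK ιK WK hD e s φ tp bN tt xg q bs as g mst hq hbrick fd hfd w hf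
    (fun γ => (∏ γ' ∈ s.attach, n γ') / n γ) (∏ γ ∈ s.attach, n γ) hD0 fun γ c' => ?_
  -- `(D / n γ) * mst γ c′ * w = (D / n γ) * n γ = D`
  rw [mul_assoc, hwst γ c', Nat.div_mul_cancel (hdvd γ)]

end Sec42Data.HeckeTranslates

end Literature.NumberTheory.Automorphic.Liu2021.AppendixC
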